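import Summits.CriticalPhenomena.Ising3DConformalLimit.Theorems.EnergyNotSigmaSquaredEnergyGapSoftPairings

/-!
# `EnergyGapSoft`: second-ratio regularity forces ratio regularity in direction `e₂`
(item stmt-CriticalPhenomena-4473, route `EnergyNotSigmaSquared`; sequel to
`EnergyNotSigmaSquaredEnergyGapSoftPairings`, continued in `…RatioRegular`)

Notation: `G = criticalTwoPoint 3`, `e₂ = Pi.single 1 1`, `β_c = criticalBeta 3`.

`secondRatioRegular_of_energyGapSoft` (file `…Pairings`) showed that the item forces the SECOND-ratio
regularity `G(x+e₂)G(x-e₂)/G(x)² → 1` uniformly in the direction of `x`. This file upgrades that to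
(first-)ratio regularity in direction `e₂`, using only two proved inputs on the two-point function —
GKS II in the form `G(x+u) G(u) ≤ G(x)` (`twoPointPlus_mul_le_twoPointPlus`) and the Simon–Lieb lower
bound `G(K e) ≥ c K⁻²` (`criticalTwoPoint_bounds_holds`):

* `exists_ray_ceiling` — the a-priori polynomial ceiling `G(x + K e) ≤ c⁻¹ K² G(x)` for unit `e`;
* `ratio_le_of_secondRatioRegular` — for a unit lattice vector `e`, second-ratio regularity in
  direction `e` forces `G(x+e)/G(x) ≤ 1 + δ` for `‖x‖ ≥ R(δ)`. Mechanism: if `G(x+e)/G(x) > 1 + δ`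
  then, consecutive ratios along `x + ℕe` differing by factors `≥ 1 - η` only, `K` consecutive
  ratios stay `≥ 1 + δ/2`, so `G(x+Ke) ≥ (1+δ/2)^K G(x)` — exponential growth against the polynomial
  ceiling;
* `ratio_near_one_of_secondRatioRegular` — applied to `e` and `-e`: `|G(x+e)/G(x) - 1| ≤ ε` for
  `‖x‖ ≥ R(ε)`;
* `ratioRegular_e₂_of_secondRatioRegular` — second-ratio regularity in direction `e₂` forces the
  cofinite limit `G(x+e₂)/G(x) → 1`.

Nothing here asserts the item.

## References

* M. Aizenman, H. Duminil-Copin, Ann. of Math. 194 (2021), §3.2 eq. (3.11), Remark 5.10, §5.6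
  [AizenmanDuminilCopinAnnals2021].
* S. Friedli, Y. Velenik, *Statistical Mechanics of Lattice Systems* (CUP 2017), Thm. 3.20
  [FriedliVelenik2017].
* B. Simon, Comm. Math. Phys. 77 (1980) 111–126, Thm. 1 [Simon1980].
-/

noncomputable section

namespace Summit.CriticalPhenomena.Ising3DConformalLimit.EnergyNotSigmaSquaredEnergyGapSoft

open scoped symmDiff
open MeasureTheory Filter Topology
open Literature.Probability.LatticeModels Literature.Probability.Percolation
open Summit.CriticalPhenomena.Ising3DConformalLimit.Theses.EnergyNotSigmaSquared
open Summit.CriticalPhenomena.Ising3DConformalLimit.PinnedClusterPoints (criticalTwoPoint_pos3)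
open Summit.CriticalPhenomena.Ising3DConformalLimit.MoebiusLimitExistsNegative (finite_norm_lt)

/-! ### A-priori control of `G(x + K e) / G(x)` -/

/-- GKS II: `G(x + u) G(u) ≤ G(x)` at `β_c` on `ℤ³`. [cite: FriedliVelenik2017, Thm. 3.20, eq. (3.22), p. 109] -/
theorem criticalTwoPoint_add_mul_le (x u : Site 3) :
    criticalTwoPoint 3 (x + u) * criticalTwoPoint 3 u ≤ criticalTwoPoint 3 x := by
  have h := twoPointPlus_mul_le_twoPointPlus (d := 3) (criticalBeta_nonneg 3) (x + u) x
  rw [show x - (x + u) = -u by abel] at h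
  change criticalTwoPoint 3 (x + u) * criticalTwoPoint 3 (-u) ≤ criticalTwoPoint 3 x at h
  rwa [criticalTwoPoint_neg] at h

/-- The norm of `K • e` for a unit lattice vector `e`. [folklore] -/
theorem norm_nsmul_unit {e : Site 3} (he : ‖e‖ = 1) (K : ℕ) : ‖K • e‖ = K := by
  rw [← Nat.cast_smul_eq_nsmul ℤ K e, norm_smul, he, mul_one, Int.norm_natCast]

/-- **Polynomial floor along a ray**: `G(K e) ≥ c K⁻²` for every unit lattice vector `e` and `K ≥ 1`
(the Simon–Lieb lower bound `⟨σ₀σ_x⟩_{β_c} ≥ c‖x‖⁻²` on `ℤ³`). [cite: Simon1980, Thm. 1] -/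
theorem exists_ray_floor :
    ∃ c : ℝ, 0 < c ∧ ∀ (e : Site 3), ‖e‖ = 1 → ∀ K : ℕ, 1 ≤ K →
      c / (K : ℝ) ^ 2 ≤ criticalTwoPoint 3 (K • e) := by
  obtain ⟨c, C, hc, hb⟩ := criticalTwoPoint_bounds_holds (d := 3) le_rfl
  refine ⟨c, hc, fun e he K hK => ?_⟩
  have hnorm : ‖K • e‖ = K := norm_nsmul_unit he K
  have hKpos : (0 : ℝ) < K := by exact_mod_cast hK
  have hne : K • e ≠ 0 := by
    intro h0
    rw [h0, norm_zero] at hnorm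
    exact hKpos.ne' hnorm.symm
  have h := (hb (K • e) hne).1
  have h31 : (-((3 : ℝ) - 1)) = -(2 : ℝ) := by norm_num
  rw [show ((3 : ℕ) : ℝ) = (3 : ℝ) by norm_num, h31, hnorm, Real.rpow_neg hKpos.le, Real.rpow_two,
    ← div_eq_mul_inv] at h
  exact h

/-- **Polynomial ceiling on ray ratios**: `G(x + K e) ≤ c⁻¹ K² G(x)` for all `x`, every unit lattice
vector `e` and `K ≥ 1` (GKS II `G(x+Ke)G(Ke) ≤ G(x)` and the floor `G(Ke) ≥ cK⁻²`). [cite: FriedliVelenik2017, Thm. 3.20, eq. (3.22), p. 109] -/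
theorem exists_ray_ceiling :
    ∃ c : ℝ, 0 < c ∧ ∀ (e : Site 3), ‖e‖ = 1 → ∀ K : ℕ, 1 ≤ K → ∀ x : Site 3,
      criticalTwoPoint 3 (x + K • e) ≤ (K : ℝ) ^ 2 / c * criticalTwoPoint 3 x := by
  obtain ⟨c, hc, hfloor⟩ := exists_ray_floor
  refine ⟨c, hc, fun e he K hK x => ?_⟩
  have hf := hfloor e he K hK
  have hKpos : (0 : ℝ) < K := by exact_mod_cast hK
  have hK2 : (0 : ℝ) < (K : ℝ) ^ 2 := by positivity
  have hmul := criticalTwoPoint_add_mul_le x (K • e)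
  have h0 : 0 ≤ criticalTwoPoint 3 (x + K • e) := criticalTwoPoint_nonneg' _
  -- `G(x+Ke) · (c/K²) ≤ G(x+Ke) G(Ke) ≤ G(x)`
  have h1 : criticalTwoPoint 3 (x + K • e) * (c / (K : ℝ) ^ 2) ≤ criticalTwoPoint 3 x :=
    (mul_le_mul_of_nonneg_left hf h0).trans hmul
  rw [mul_div_assoc', div_le_iff₀ hK2] at h1
  rw [div_mul_eq_mul_div, le_div_iff₀ hc]
  linarith

/-! ### Second-ratio regularity forces one-sided ratio bounds -/

/-- A far point stays far along a short ray: `‖x‖ - j ≤ ‖x + j e‖` for a unit vector `e`. [folklore] -/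
theorem norm_sub_le_norm_add_nsmul {e : Site 3} (he : ‖e‖ = 1) (x : Site 3) (j : ℕ) :
    ‖x‖ - j ≤ ‖x + j • e‖ := by
  have h : ‖x‖ ≤ ‖x + j • e‖ + ‖j • e‖ := by
    calc ‖x‖ = ‖(x + j • e) - j • e‖ := by rw [add_sub_cancel_right]
      _ ≤ ‖x + j • e‖ + ‖j • e‖ := norm_sub_le _ _
  rw [norm_nsmul_unit he] at h
  linarith

/-- Exponential beats polynomial: for `a > 1` and `c > 0` there is `K ≥ 1` with `K²/c < a^K`. [folklore] -/
theorem exists_nat_sq_div_lt_pow {a c : ℝ} (ha : 1 < a) (hc : 0 < c) :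
    ∃ K : ℕ, 1 ≤ K ∧ (K : ℝ) ^ 2 / c < a ^ K := by
  have ht := tendsto_pow_const_div_const_pow_of_one_lt 2 ha
  have hev : ∀ᶠ n : ℕ in atTop, (n : ℝ) ^ 2 / a ^ n < c := ht (Iio_mem_nhds hc)
  rw [eventually_atTop] at hev
  obtain ⟨N, hN⟩ := hev
  refine ⟨max N 1, le_max_right _ _, ?_⟩
  have h := hN (max N 1) (le_max_left _ _)
  have hapos : 0 < a ^ (max N 1) := pow_pos (by linarith) _
  rw [div_lt_iff₀ hapos] at h
  rw [div_lt_iff₀ hc]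
  linarith [mul_comm c (a ^ max N 1)]

/-- **Second-ratio regularity in a unit direction `e` forces `G(x+e)/G(x) ≤ 1 + δ` eventually.**
If `G(y+e)G(y-e)/G(y)² → 1` as `‖y‖ → ∞` then for every `δ > 0` there is `R` with
`G(x+e)/G(x) ≤ 1 + δ` whenever `‖x‖ ≥ R`: otherwise `K` consecutive ratios along `x + ℕe` stay
`≥ 1 + δ/2` and `G(x+Ke) ≥ (1+δ/2)^K G(x)` contradicts the polynomial ceiling
`G(x+Ke) ≤ c⁻¹K²G(x)`. [cite: AizenmanDuminilCopinAnnals2021, Remark 5.10] -/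
theorem ratio_le_of_secondRatioRegular {e : Site 3} (he : ‖e‖ = 1)
    (hS : ∀ η : ℝ, 0 < η → ∃ R : ℝ, ∀ y : Site 3, R ≤ ‖y‖ →
      |criticalTwoPoint 3 (y + e) * criticalTwoPoint 3 (y - e) / criticalTwoPoint 3 y ^ 2 - 1| ≤ η)
    (δ : ℝ) (hδ : 0 < δ) :
    ∃ R : ℝ, ∀ x : Site 3, R ≤ ‖x‖ → criticalTwoPoint 3 (x + e) / criticalTwoPoint 3 x ≤ 1 + δ := by
  have hGpos : ∀ v, 0 < criticalTwoPoint 3 v := criticalTwoPoint_pos3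
  obtain ⟨c, hc, hceil⟩ := exists_ray_ceiling
  -- the growth factor `a` and the number of steps `K`
  set a : ℝ := 1 + δ / 2 with ha_def
  have ha1 : 1 < a := by rw [ha_def]; linarith
  obtain ⟨K, hK1, hK⟩ := exists_nat_sq_div_lt_pow ha1 hc
  have hKpos : (0 : ℝ) < K := by exact_mod_cast hK1
  have hK1' : (1 : ℝ) ≤ K := by exact_mod_cast hK1
  -- the tolerance `η`, chosen with `(1 + δ)(1 - K η) = a`
  set η : ℝ := δ / (2 * K * (1 + δ)) with hη_def
  have hηpos : 0 < η := by rw [hη_def]; positivity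
  have hKη : (1 + δ) * (1 - K * η) = a := by
    rw [hη_def, ha_def]; field_simp; ring
  have hKη' : (K : ℝ) * η = δ / (2 * (1 + δ)) := by
    rw [hη_def]; field_simp
  have hKη_le : (K : ℝ) * η ≤ 1 / 2 := by
    rw [hKη', div_le_div_iff₀ (by positivity) (by norm_num)]
    linarith
  have hη1 : η ≤ 1 / 2 := by
    have : η ≤ K * η := le_mul_of_one_le_left hηpos.le hK1'
    linarith
  have h1η : 0 ≤ 1 - η := by linarith
  obtain ⟨R, hR⟩ := hS η hηpos
  refine ⟨R + K, fun x hx => ?_⟩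
  by_contra hlt
  push Not at hlt
  -- consecutive ratios along the ray `x + ℕ e`
  set r : ℕ → ℝ := fun j =>
    criticalTwoPoint 3 (x + (j + 1) • e) / criticalTwoPoint 3 (x + j • e) with hr_def
  have hrpos : ∀ j, 0 < r j := fun j => div_pos (hGpos _) (hGpos _)
  have hfar : ∀ j : ℕ, j ≤ K → R ≤ ‖x + j • e‖ := by
    intro j hj
    have h := norm_sub_le_norm_add_nsmul he x j
    have hjK : (j : ℝ) ≤ K := by exact_mod_cast hj
    linarith
  -- (i) consecutive ratios shrink at most by the factor `1 - η`
  have hstep : ∀ j : ℕ, j + 1 ≤ K → (1 - η) * r j ≤ r (j + 1) := by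
    intro j hj
    have hy := hR (x + (j + 1) • e) (hfar (j + 1) hj)
    have hsub : x + (j + 1) • e - e = x + j • e := by
      rw [succ_nsmul, ← add_assoc, add_sub_cancel_right]
    have hadd : x + (j + 1) • e + e = x + (j + 1 + 1) • e := by
      rw [succ_nsmul e (j + 1), add_assoc]
    rw [hsub, hadd] at hy
    have hlow := (abs_le.1 hy).1
    have hG2 : 0 < criticalTwoPoint 3 (x + (j + 1) • e) ^ 2 := pow_pos (hGpos _) 2
    -- `(1 - η) G(y)² ≤ G(y+e) G(y-e)` with `y = x + (j+1)e`
    have hprod : (1 - η) * criticalTwoPoint 3 (x + (j + 1) • e) ^ 2 ≤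
        criticalTwoPoint 3 (x + (j + 1 + 1) • e) * criticalTwoPoint 3 (x + j • e) := by
      have h' : 1 - η ≤ criticalTwoPoint 3 (x + (j + 1 + 1) • e) * criticalTwoPoint 3 (x + j • e) /
          criticalTwoPoint 3 (x + (j + 1) • e) ^ 2 := by linarith
      rwa [le_div_iff₀ hG2] at h'
    show (1 - η) * (criticalTwoPoint 3 (x + (j + 1) • e) / criticalTwoPoint 3 (x + j • e)) ≤
      criticalTwoPoint 3 (x + (j + 1 + 1) • e) / criticalTwoPoint 3 (x + (j + 1) • e)
    rw [mul_div_assoc', div_le_div_iff₀ (hGpos _) (hGpos _)]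
    nlinarith [hGpos (x + (j + 1) • e), hGpos (x + j • e)]
  -- (ii) hence they stay above `(1 + δ)(1 - η)^j ≥ a` for `K` steps
  have hdecay : ∀ j : ℕ, j + 1 ≤ K → (1 + δ) * (1 - η) ^ j ≤ r j := by
    intro j
    induction j with
    | zero =>
      intro _
      have h0 : r 0 = criticalTwoPoint 3 (x + e) / criticalTwoPoint 3 x := by
        simp only [hr_def, zero_add, one_nsmul, zero_nsmul, add_zero]
      rw [pow_zero, mul_one, h0]
      exact hlt.le
    | succ j ih =>
      intro hj
      have ih' := ih (by omega)
      calc (1 + δ) * (1 - η) ^ (j + 1) = (1 - η) * ((1 + δ) * (1 - η) ^ j) := by ring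
        _ ≤ (1 - η) * r j := mul_le_mul_of_nonneg_left ih' h1η
        _ ≤ r (j + 1) := hstep j (by omega)
  have hge : ∀ j : ℕ, j + 1 ≤ K → a ≤ r j := by
    intro j hj
    have hbern : 1 + (K : ℝ) * (-η) ≤ (1 + (-η)) ^ K := one_add_mul_le_pow (by linarith) K
    have hpow : (1 - η) ^ K ≤ (1 - η) ^ j := pow_le_pow_of_le_one h1η (by linarith) (by omega)
    calc a = (1 + δ) * (1 - K * η) := hKη.symm
      _ ≤ (1 + δ) * (1 - η) ^ K := by
          apply mul_le_mul_of_nonneg_left _ (by linarith)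
          have : (1 : ℝ) + K * -η = 1 - K * η := by ring
          have h2 : (1 : ℝ) + -η = 1 - η := by ring
          rw [this, h2] at hbern
          exact hbern
      _ ≤ (1 + δ) * (1 - η) ^ j := mul_le_mul_of_nonneg_left hpow (by linarith)
      _ ≤ r j := hdecay j hj
  -- (iii) so `G` grows geometrically along the ray
  have hgrow : ∀ j : ℕ, j ≤ K → a ^ j * criticalTwoPoint 3 x ≤ criticalTwoPoint 3 (x + j • e) := by
    intro j
    induction j with
    | zero => intro _; simp
    | succ j ih =>
      intro hj
      have ih' := ih (by omega)
      have hrj := hge j hj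
      have heq : criticalTwoPoint 3 (x + (j + 1) • e) = r j * criticalTwoPoint 3 (x + j • e) := by
        simp only [hr_def]
        rw [div_mul_cancel₀ _ (hGpos _).ne']
      rw [heq, pow_succ, show a ^ j * a * criticalTwoPoint 3 x = a * (a ^ j * criticalTwoPoint 3 x) by ring]
      exact mul_le_mul hrj ih' (mul_nonneg (pow_nonneg (by linarith) _) (hGpos x).le) (hrpos j).le
  -- (iv) against the polynomial ceiling
  have htop := hgrow K le_rfl
  have hceilK := hceil e he K hK1 x
  have hGx := hGpos x
  have : a ^ K * criticalTwoPoint 3 x ≤ (K : ℝ) ^ 2 / c * criticalTwoPoint 3 x := htop.trans hceilK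
  have hfin : a ^ K ≤ (K : ℝ) ^ 2 / c := le_of_mul_le_mul_right this hGx
  linarith

/-- Second-ratio regularity is symmetric under `e ↦ -e`. [folklore] -/
theorem secondRatioRegular_neg {e : Site 3}
    (hS : ∀ η : ℝ, 0 < η → ∃ R : ℝ, ∀ y : Site 3, R ≤ ‖y‖ →
      |criticalTwoPoint 3 (y + e) * criticalTwoPoint 3 (y - e) / criticalTwoPoint 3 y ^ 2 - 1| ≤ η) :
    ∀ η : ℝ, 0 < η → ∃ R : ℝ, ∀ y : Site 3, R ≤ ‖y‖ →
      |criticalTwoPoint 3 (y + -e) * criticalTwoPoint 3 (y - -e) / criticalTwoPoint 3 y ^ 2 - 1| ≤ η := by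
  intro η hη
  obtain ⟨R, hR⟩ := hS η hη
  refine ⟨R, fun y hy => ?_⟩
  rw [← sub_eq_add_neg, sub_neg_eq_add, mul_comm]
  exact hR y hy

/-- **Second-ratio regularity in direction `e` forces two-sided ratio regularity in direction `e`**
(`ε`-`R` form): `|G(x+e)/G(x) - 1| ≤ ε` for `‖x‖ ≥ R(ε)`, for any unit lattice vector `e`.
[cite: AizenmanDuminilCopinAnnals2021, Remark 5.10] -/
theorem ratio_near_one_of_secondRatioRegular {e : Site 3} (he : ‖e‖ = 1)
    (hS : ∀ η : ℝ, 0 < η → ∃ R : ℝ, ∀ y : Site 3, R ≤ ‖y‖ →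
      |criticalTwoPoint 3 (y + e) * criticalTwoPoint 3 (y - e) / criticalTwoPoint 3 y ^ 2 - 1| ≤ η)
    (ε : ℝ) (hε : 0 < ε) :
    ∃ R : ℝ, ∀ x : Site 3, R ≤ ‖x‖ → |criticalTwoPoint 3 (x + e) / criticalTwoPoint 3 x - 1| ≤ ε := by
  have hGpos : ∀ v, 0 < criticalTwoPoint 3 v := criticalTwoPoint_pos3
  have he' : ‖-e‖ = 1 := by rw [norm_neg, he]
  obtain ⟨R₁, hR₁⟩ := ratio_le_of_secondRatioRegular he hS ε hε
  obtain ⟨R₂, hR₂⟩ := ratio_le_of_secondRatioRegular he' (secondRatioRegular_neg hS) ε hε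
  refine ⟨max R₁ (R₂ + 1), fun x hx => ?_⟩
  have h1 := hR₁ x ((le_max_left _ _).trans hx)
  -- the lower bound from the `-e` direction at the point `x + e`
  have hxe : R₂ ≤ ‖x + e‖ := by
    have h := norm_sub_le_norm_add_nsmul he x 1
    rw [one_nsmul, Nat.cast_one] at h
    linarith [(le_max_right _ _).trans hx]
  have h2 := hR₂ (x + e) hxe
  rw [add_neg_cancel_right] at h2
  -- `G(x)/G(x+e) ≤ 1 + ε` gives `G(x+e)/G(x) ≥ 1/(1+ε) ≥ 1 - ε`
  have hq : 0 < criticalTwoPoint 3 (x + e) / criticalTwoPoint 3 x := div_pos (hGpos _) (hGpos _)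
  have hinv : criticalTwoPoint 3 x / criticalTwoPoint 3 (x + e) =
      (criticalTwoPoint 3 (x + e) / criticalTwoPoint 3 x)⁻¹ := by rw [inv_div]
  rw [hinv] at h2
  rw [abs_le]
  constructor
  · -- lower
    have h3 : 1 ≤ (1 + ε) * (criticalTwoPoint 3 (x + e) / criticalTwoPoint 3 x) := by
      have := mul_le_mul_of_nonneg_right h2 hq.le
      rwa [inv_mul_cancel₀ hq.ne'] at this
    nlinarith
  · linarith

/-! ### From `ε`-`R` statements to cofinite limits -/

/-- An `ε`-`R` statement on `ℤ³` is a cofinite limit. [folklore] -/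
theorem tendsto_cofinite_of_radius {f : Site 3 → ℝ} {a : ℝ}
    (h : ∀ ε : ℝ, 0 < ε → ∃ R : ℝ, ∀ x : Site 3, R ≤ ‖x‖ → |f x - a| ≤ ε) :
    Tendsto f cofinite (𝓝 a) := by
  rw [Metric.tendsto_nhds]
  intro ε hε
  obtain ⟨R, hR⟩ := h (ε / 2) (by positivity)
  rw [Filter.eventually_cofinite]
  refine (finite_norm_lt R).subset fun x hx => ?_
  rw [Set.mem_setOf_eq] at hx ⊢
  by_contra hxR
  push Not at hxR
  have := hR x hxR
  rw [Real.dist_eq] at hx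
  exact hx (lt_of_le_of_lt this (by linarith))

/-- **Second-ratio regularity in direction `e₂` forces ratio regularity in direction `e₂`.**
[cite: AizenmanDuminilCopinAnnals2021, Remark 5.10] -/
theorem ratioRegular_e₂_of_secondRatioRegular
    (hS : ∀ η : ℝ, 0 < η → ∃ R : ℝ, ∀ y : Site 3, R ≤ ‖y‖ →
      |criticalTwoPoint 3 (y + Pi.single 1 1) * criticalTwoPoint 3 (y - Pi.single 1 1) /
          criticalTwoPoint 3 y ^ 2 - 1| ≤ η) :
    Tendsto (fun x : Site 3 => criticalTwoPoint 3 (x + Pi.single 1 1) / criticalTwoPoint 3 x)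
      cofinite (𝓝 1) := by
  have he : ‖(Pi.single 1 1 : Site 3)‖ = 1 := by
    rw [Pi.norm_single]; simp
  exact tendsto_cofinite_of_radius (ratio_near_one_of_secondRatioRegular he hS)

end Summit.CriticalPhenomena.Ising3DConformalLimit.EnergyNotSigmaSquaredEnergyGapSoft

end
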